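import Literature.Topology.FourManifolds.LongAnnulusShear
import Literature.Topology.FourManifolds.ArcTube
import HarnessLib

/-!
# Re-levelling a long annulus along its sheared spanning arc

Topic `Literature/Topology/FourManifolds`; third infrastructure file (after `LongAnnulusShear.lean`,
`ArcTube.lean`) of the straightening of a spanning arc in the proof programme of the Fox–Milnor
fact `Literature.Topology.FourManifolds.Knot.exists_isConnectedSum_isConcordant`. Everything here
is proved; no named fact is introduced.

After the generic double shear (`LongAnnulus.exists_generic_shear`), the spatial projection
`x_v = spos v θ₁` of the spanning arc `τ ↦ F (θ₁, τ)` is an embedded arc over the middle of the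
parameter interval, but the *level* `lev θ₁ τ` along it need not be monotone. This file makes the
arc **level-true** — `F' (θ₁, τ) = (x_v τ, τ)` for all `τ ∈ [1, 2]` — by an explicit fibrewise
diffeomorphism of `ℝ³ × ℝ` acting on the levels only:

* `Relevel.plateau η` — a smooth cut-off `ℝ → [0, 1]`, `1` on `[1 + 3η/8, 2 - 3η/8]`, `0` off
  `(1 + η/4, 2 - η/4)`, with bounded derivative.
* `Relevel.R c B (x, t) = (x, t + c x · B t)` — for `C^∞` `c : ℝ³ → ℝ`, `B : ℝ → ℝ` with
  `|c| · sup |B'| < 1`: smooth, strictly increasing on each vertical line, hence injective, with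
  injective differential, the identity where `B t = 0`, preserving the level zones, and
  *translating by `c x` wherever `B = 1` along the way*; the same for its iterates
  (`Relevel.iterate_R_*`).
* `LongAnnulus.exists_relevel` — **given a generic shear parameter `v` for `(A, θ₁)`, there is a
  long annulus `B` of width `η/4` with the same end curves, the same positions as the sheared
  annulus `A.shearWith v`, the same levels off the open middle, and level-true spanning arc
  `B.F (θ₁, τ) = (spos v θ₁ τ, τ)` on `[1, 2]`.** Construction: extend `φ τ = τ - lev θ₁ τ` from
  the embedded middle arc to a smooth `g` on `ℝ³` supported near the non-collar part of the arc
  (`ArcTube.exists_contDiff_extend`, the support radius below the distance from the collar flanks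
  of the arc), and apply the `N`-fold iterate of `R (g/N) plateau` with `N` large: along the arc
  every step translates the level by `φ τ / N` inside the plateau.

## References

* M. W. Hirsch, *Differential Topology*, GTM 33 (1976), Ch. 8 §1 (isotopies written as
  compositions of small explicit moves). [HirschDT1976]
* A. A. Kosinski, *Differential Manifolds* (1993), II (2.8.2) (normalising a neat submanifold in
  a collar; here for one arc, by hand). [Kosinski1993]

## Design notes

No named facts, no `sorry`; `𝔼 n` is local notation as in `Knots.lean`.
-/

open scoped Topology ContDiff
open Function Set Metric Filter

noncomputable section

namespace Literature.Topology.FourManifolds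

/-- Local notation: `𝔼 n` is the model Euclidean space `EuclideanSpace ℝ (Fin n)`. -/
local notation "𝔼 " n:arg => EuclideanSpace ℝ (Fin n)

namespace Relevel

/-! ### The plateau cut-off -/

/-- The **plateau** of width `η`: `1` on `[1 + 3η/8, 2 - 3η/8]`, `0` off `(1 + η/4, 2 - η/4)`.
[folklore] -/
def plateau (η t : ℝ) : ℝ :=
  Real.smoothTransition ((t - (1 + η / 4)) / (η / 8)) *
    Real.smoothTransition (((2 - η / 4) - t) / (η / 8))

variable {η : ℝ}

/-- The plateau is `C^∞`. [folklore] -/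
theorem contDiff_plateau (η : ℝ) : ContDiff ℝ ∞ (plateau η) :=
  (Real.smoothTransition.contDiff.comp ((contDiff_id.sub contDiff_const).div_const _)).mul
    (Real.smoothTransition.contDiff.comp ((contDiff_const.sub contDiff_id).div_const _))

/-- `0 ≤ plateau ≤ 1`. [folklore] -/
theorem plateau_mem_Icc (η t : ℝ) : plateau η t ∈ Icc (0 : ℝ) 1 :=
  ⟨mul_nonneg (Real.smoothTransition.nonneg _) (Real.smoothTransition.nonneg _),
    mul_le_one₀ (Real.smoothTransition.le_one _) (Real.smoothTransition.nonneg _)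
      (Real.smoothTransition.le_one _)⟩

/-- The plateau is `1` on `[1 + 3η/8, 2 - 3η/8]` (`η > 0`). [folklore] -/
theorem plateau_eq_one (hη : 0 < η) {t : ℝ} (ht : t ∈ Icc (1 + 3 * η / 8) (2 - 3 * η / 8)) :
    plateau η t = 1 := by
  rw [plateau, Real.smoothTransition.one_of_one_le, Real.smoothTransition.one_of_one_le, one_mul]
  · rw [le_div_iff₀ (by positivity)]; linarith [ht.2]
  · rw [le_div_iff₀ (by positivity)]; linarith [ht.1]

/-- The plateau vanishes for `t ≤ 1 + η/4` (`η > 0`). [folklore] -/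
theorem plateau_of_le (hη : 0 < η) {t : ℝ} (ht : t ≤ 1 + η / 4) : plateau η t = 0 := by
  rw [plateau, Real.smoothTransition.zero_of_nonpos, zero_mul]
  exact div_nonpos_of_nonpos_of_nonneg (by linarith) (by positivity)

/-- The plateau vanishes for `t ≥ 2 - η/4` (`η > 0`). [folklore] -/
theorem plateau_of_ge (hη : 0 < η) {t : ℝ} (ht : 2 - η / 4 ≤ t) : plateau η t = 0 := by
  rw [plateau, Real.smoothTransition.zero_of_nonpos (x := ((2 - η / 4) - t) / (η / 8)), mul_zero]
  exact div_nonpos_of_nonpos_of_nonneg (by linarith) (by positivity)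

/-- Off the open middle the plateau vanishes. [folklore] -/
theorem plateau_of_not_mem (hη : 0 < η) {t : ℝ} (ht : t ∉ Ioo (1 + η / 4) (2 - η / 4)) :
    plateau η t = 0 := by
  rcases not_and_or.1 ht with h | h
  · exact plateau_of_le hη (not_lt.1 h)
  · exact plateau_of_ge hη (not_lt.1 h)

/-- **The derivative of the plateau is bounded.** [folklore] -/
theorem exists_abs_deriv_plateau_le (hη : 0 < η) : ∃ K : ℝ, 0 < K ∧ ∀ t, |deriv (plateau η) t| ≤ K := by
  have hd : Continuous (deriv (plateau η)) := (contDiff_plateau η).continuous_deriv (by simp)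
  obtain ⟨K, hK⟩ := isCompact_Icc.exists_bound_of_continuousOn (s := Icc (1 : ℝ) 2) hd.continuousOn
  refine ⟨max K 1, by positivity, fun t ↦ ?_⟩
  by_cases ht : t ∈ Icc (1 : ℝ) 2
  · exact ((Real.norm_eq_abs _).symm.le.trans (hK t ht)).trans (le_max_left _ _)
  · -- off `[1, 2]` the plateau is locally constant zero
    have hzero : deriv (plateau η) t = 0 := by
      rcases not_and_or.1 ht with h | h
      · have hev : plateau η =ᶠ[𝓝 t] fun _ ↦ (0 : ℝ) := by
          filter_upwards [Iio_mem_nhds (not_le.1 h)] with s hs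
          exact plateau_of_le hη (by linarith [mem_Iio.1 hs])
        rw [hev.deriv_eq, deriv_const]
      · have hev : plateau η =ᶠ[𝓝 t] fun _ ↦ (0 : ℝ) := by
          filter_upwards [Ioi_mem_nhds (not_le.1 h)] with s hs
          exact plateau_of_ge hη (by linarith [mem_Ioi.1 hs])
        rw [hev.deriv_eq, deriv_const]
    rw [hzero, abs_zero]
    positivity

/-! ### The fibrewise level move -/

section R

variable (c : 𝔼 3 → ℝ) (B : ℝ → ℝ)

/-- **The fibrewise level move** `R c B (x, t) = (x, t + c x · B t)`. [folklore] -/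
def R (p : 𝔼 3 × ℝ) : 𝔼 3 × ℝ := (p.1, p.2 + c p.1 * B p.2)

/-- The level map of the move on the vertical line over `x`. [folklore] -/
def lmap (x : 𝔼 3) (t : ℝ) : ℝ := t + c x * B t

variable {c B}

/-- The position is preserved. [folklore] -/
@[simp] theorem R_fst (p : 𝔼 3 × ℝ) : (R c B p).1 = p.1 := rfl

/-- The new level. [folklore] -/
@[simp] theorem R_snd (p : 𝔼 3 × ℝ) : (R c B p).2 = lmap c B p.1 p.2 := rfl

/-- The move on a pair. [folklore] -/
theorem R_mk (x : 𝔼 3) (t : ℝ) : R c B (x, t) = (x, lmap c B x t) := rfl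

/-- The move is `C^∞`. [folklore] -/
theorem contDiff_R (hc : ContDiff ℝ ∞ c) (hB : ContDiff ℝ ∞ B) : ContDiff ℝ ∞ (R c B) :=
  contDiff_fst.prodMk (contDiff_snd.add ((hc.comp contDiff_fst).mul (hB.comp contDiff_snd)))

/-- The level map is `C^∞` in the level. [folklore] -/
theorem contDiff_lmap (hB : ContDiff ℝ ∞ B) (x : 𝔼 3) : ContDiff ℝ ∞ (lmap c B x) :=
  contDiff_id.add (contDiff_const.mul hB)

/-- The derivative of the level map. [folklore] -/
theorem hasDerivAt_lmap (hB : ContDiff ℝ ∞ B) (x : 𝔼 3) (t : ℝ) :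
    HasDerivAt (lmap c B x) (1 + c x * deriv B t) t :=
  (hasDerivAt_id t).add (((hB.differentiable (by simp)) t).hasDerivAt.const_mul (c x))

variable {K : ℝ} (hB : ContDiff ℝ ∞ B) (hK : ∀ t, |deriv B t| ≤ K) (hcK : ∀ x, |c x| * K < 1)
include hB hK hcK

omit hB in
/-- The derivative of the level map is positive (`|c| · sup |B'| < 1`). [folklore] -/
theorem deriv_lmap_pos (x : 𝔼 3) (t : ℝ) : 0 < 1 + c x * deriv B t := by
  have h1 : |c x * deriv B t| < 1 := by
    rw [abs_mul]
    exact lt_of_le_of_lt (mul_le_mul_of_nonneg_left (hK t) (abs_nonneg _)) (hcK x)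
  have := neg_abs_le (c x * deriv B t)
  linarith

/-- The level map is strictly increasing. [folklore] -/
theorem strictMono_lmap (x : 𝔼 3) : StrictMono (lmap c B x) :=
  strictMono_of_deriv_pos fun t ↦ by
    rw [(hasDerivAt_lmap hB x t).deriv]; exact deriv_lmap_pos hK hcK x t

/-- The move is injective. [folklore] -/
theorem R_injective : Injective (R c B) := by
  rintro ⟨x, t⟩ ⟨x', t'⟩ h
  simp only [R_mk, Prod.mk.injEq] at h
  obtain ⟨rfl, h2⟩ := h
  exact Prod.ext rfl ((strictMono_lmap hB hK hcK x).injective h2)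

/-- **The differential of the move is injective.** The first component of `DR (ξ, θ)` is `ξ`;
on vertical vectors `DR (0, θ) = (0, lmap' θ)` with `lmap' > 0`. [folklore] -/
theorem injective_fderiv_R (hc : ContDiff ℝ ∞ c) (p : 𝔼 3 × ℝ) : Injective (fderiv ℝ (R c B) p) := by
  have hd : DifferentiableAt ℝ (R c B) p := ((contDiff_R hc hB).differentiable (by simp)) p
  -- first component of the differential
  have hfst : ∀ w : 𝔼 3 × ℝ, (fderiv ℝ (R c B) p w).1 = w.1 := by
    intro w
    have h1 : HasFDerivAt (fun q : 𝔼 3 × ℝ ↦ (R c B q).1)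
        ((ContinuousLinearMap.fst ℝ (𝔼 3) ℝ).comp (fderiv ℝ (R c B) p)) p := hd.hasFDerivAt.fst
    have h2 : HasFDerivAt (fun q : 𝔼 3 × ℝ ↦ (R c B q).1) (ContinuousLinearMap.fst ℝ (𝔼 3) ℝ) p :=
      hasFDerivAt_fst
    have := congrArg (fun L : 𝔼 3 × ℝ →L[ℝ] 𝔼 3 ↦ L w) (h1.unique h2)
    simpa using this
  -- the vertical derivative
  have hvert : ∀ θ : ℝ, fderiv ℝ (R c B) p ((0, θ) : 𝔼 3 × ℝ) =
      ((0 : 𝔼 3), (1 + c p.1 * deriv B p.2) * θ) := by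
    intro θ
    have hcurve : HasDerivAt (fun s : ℝ ↦ ((p.1, s) : 𝔼 3 × ℝ)) ((0, 1) : 𝔼 3 × ℝ) p.2 :=
      (hasDerivAt_const _ _).prodMk (hasDerivAt_id _)
    have hcomp : HasDerivAt (fun s : ℝ ↦ R c B (p.1, s)) (fderiv ℝ (R c B) p ((0, 1) : 𝔼 3 × ℝ)) p.2 := by
      have := hd.hasFDerivAt.comp_hasDerivAt p.2 hcurve
      exact this
    have hdirect : HasDerivAt (fun s : ℝ ↦ R c B (p.1, s)) (((0 : 𝔼 3), 1 + c p.1 * deriv B p.2)) p.2 :=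
      (hasDerivAt_const _ _).prodMk (hasDerivAt_lmap hB p.1 p.2)
    have heq := hcomp.unique hdirect
    have hlin : fderiv ℝ (R c B) p ((0, θ) : 𝔼 3 × ℝ) = θ • fderiv ℝ (R c B) p ((0, 1) : 𝔼 3 × ℝ) := by
      rw [← ContinuousLinearMap.map_smul]
      congr 1
      simp
    rw [hlin, heq, Prod.smul_mk, smul_zero, smul_eq_mul, mul_comm]
  refine (injective_iff_map_eq_zero _).2 fun w hw ↦ ?_
  obtain ⟨ξ, θ⟩ := w
  have hξ : ξ = 0 := by simpa using (hfst (ξ, θ)).symm.trans (by rw [hw]; rfl)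
  subst hξ
  rw [hvert θ, Prod.mk_eq_zero] at hw
  have hθ : θ = 0 := (mul_eq_zero.1 hw.2).resolve_left (deriv_lmap_pos hK hcK p.1 p.2).ne'
  simp [hθ]

omit hB hK hcK in
/-- Where `B t = 0` the move is the identity. [folklore] -/
theorem R_of_B_eq_zero {p : 𝔼 3 × ℝ} (h : B p.2 = 0) : R c B p = p := by
  obtain ⟨x, t⟩ := p
  simp only [R_mk, lmap, Prod.mk.injEq, true_and]
  simp only at h
  rw [h, mul_zero, add_zero]

/-- **The level map preserves an open interval off which `B` vanishes.** [folklore] -/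
theorem lmap_mem_Ioo {α β : ℝ} (hBz : ∀ t ∉ Ioo α β, B t = 0) (x : 𝔼 3) {t : ℝ} (ht : t ∈ Ioo α β) :
    lmap c B x t ∈ Ioo α β := by
  have hmono := strictMono_lmap hB hK hcK x
  have hα : lmap c B x α = α := by
    simp [lmap, hBz α (fun h ↦ lt_irrefl _ h.1)]
  have hβ : lmap c B x β = β := by
    simp [lmap, hBz β (fun h ↦ lt_irrefl _ h.2)]
  exact ⟨hα ▸ hmono ht.1, hβ ▸ hmono ht.2⟩

omit hB hK hcK in
/-- Off that open interval the level map is the identity. [folklore] -/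
theorem lmap_of_not_mem {α β : ℝ} (hBz : ∀ t ∉ Ioo α β, B t = 0) (x : 𝔼 3) {t : ℝ} (ht : t ∉ Ioo α β) :
    lmap c B x t = t := by
  simp [lmap, hBz t ht]

omit hB hK hcK in
/-- **Translation inside a plateau**: if `B = 1` on an interval `[a, b]` containing `t` and
`t + n c x` (hence the segment between them), then the `k`-fold iterates of the level map
translate `t` by `k c x` for all `k ≤ n`. [folklore] -/
theorem iterate_lmap_eq_add {x : 𝔼 3} {t : ℝ} {n : ℕ} {a b : ℝ}
    (hBone : ∀ s ∈ Icc a b, B s = 1) (ht : t ∈ Icc a b) (htn : t + n * c x ∈ Icc a b) :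
    ∀ k ≤ n, (lmap c B x)^[k] t = t + k * c x := by
  -- the segment between `t` and `t + n c x` lies in `[a, b]`
  have hseg : ∀ k ≤ n, t + k * c x ∈ Icc a b := by
    intro k hk
    have hk' : (k : ℝ) ≤ n := by exact_mod_cast hk
    rcases le_or_gt 0 (c x) with hc0 | hc0
    · exact ⟨by nlinarith [ht.1], by nlinarith [htn.2]⟩
    · exact ⟨by nlinarith [htn.1], by nlinarith [ht.2]⟩
  intro k hk
  induction k with
  | zero => simp
  | succ k ih =>
    have hk' : k ≤ n := Nat.le_of_succ_le hk
    rw [Function.iterate_succ_apply', ih hk', lmap, hBone _ (hseg k hk')]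
    push_cast
    ring

end R

/-! ### Iterates of the move -/

section Iterate

variable {c : 𝔼 3 → ℝ} {B : ℝ → ℝ} {K : ℝ}

/-- The iterates of the move keep the position and iterate the level map. [folklore] -/
theorem iterate_R_mk (n : ℕ) (x : 𝔼 3) (t : ℝ) : (R c B)^[n] (x, t) = (x, (lmap c B x)^[n] t) := by
  induction n generalizing t with
  | zero => rfl
  | succ n ih => rw [Function.iterate_succ_apply, Function.iterate_succ_apply, R_mk, ih]

/-- The iterates are `C^∞`. [folklore] -/
theorem contDiff_iterate_R (hc : ContDiff ℝ ∞ c) (hB : ContDiff ℝ ∞ B) (n : ℕ) :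
    ContDiff ℝ ∞ ((R c B)^[n]) := by
  induction n with
  | zero => exact contDiff_id
  | succ n ih => rw [Function.iterate_succ']; exact (contDiff_R hc hB).comp ih

/-- The iterates are injective. [folklore] -/
theorem iterate_R_injective (hB : ContDiff ℝ ∞ B) (hK : ∀ t, |deriv B t| ≤ K)
    (hcK : ∀ x, |c x| * K < 1) (n : ℕ) : Injective ((R c B)^[n]) :=
  (R_injective hB hK hcK).iterate n

/-- The iterates have injective differential. [folklore] -/
theorem injective_fderiv_iterate_R (hc : ContDiff ℝ ∞ c) (hB : ContDiff ℝ ∞ B)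
    (hK : ∀ t, |deriv B t| ≤ K) (hcK : ∀ x, |c x| * K < 1) (n : ℕ) (p : 𝔼 3 × ℝ) :
    Injective (fderiv ℝ ((R c B)^[n]) p) := by
  induction n generalizing p with
  | zero => rw [Function.iterate_zero, fderiv_id]; exact fun a b h ↦ by simpa using h
  | succ n ih =>
    rw [Function.iterate_succ']
    have hd : DifferentiableAt ℝ ((R c B)^[n]) p := ((contDiff_iterate_R hc hB n).differentiable (by simp)) p
    have hd' : DifferentiableAt ℝ (R c B) ((R c B)^[n] p) := ((contDiff_R hc hB).differentiable (by simp)) _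
    rw [fderiv_comp p hd' hd]
    exact (injective_fderiv_R hB hK hcK hc _).comp (ih p)

/-- The iterated level map preserves the open interval off which `B` vanishes. [folklore] -/
theorem iterate_lmap_mem_Ioo (hB : ContDiff ℝ ∞ B) (hK : ∀ t, |deriv B t| ≤ K)
    (hcK : ∀ x, |c x| * K < 1) {α β : ℝ} (hBz : ∀ t ∉ Ioo α β, B t = 0) (x : 𝔼 3) (n : ℕ) {t : ℝ}
    (ht : t ∈ Ioo α β) : (lmap c B x)^[n] t ∈ Ioo α β := by
  induction n with
  | zero => exact ht
  | succ n ih => rw [Function.iterate_succ_apply']; exact lmap_mem_Ioo hB hK hcK hBz x ih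

/-- Off that interval the iterated level map is the identity. [folklore] -/
theorem iterate_lmap_of_not_mem {α β : ℝ} (hBz : ∀ t ∉ Ioo α β, B t = 0) (x : 𝔼 3) (n : ℕ) {t : ℝ}
    (ht : t ∉ Ioo α β) : (lmap c B x)^[n] t = t := by
  induction n with
  | zero => rfl
  | succ n ih => rw [Function.iterate_succ_apply', ih]; exact lmap_of_not_mem hBz x ht

end Iterate

end Relevel

/-! ### The iterated level move as an operation on long annuli -/

namespace LongAnnulus

open ArcShear Relevel

variable {η : ℝ} (A : LongAnnulus η)

section IterRelevel

variable (c : 𝔼 3 → ℝ) (B : ℝ → ℝ) {K : ℝ} (hc : ContDiff ℝ ∞ c) (hB : ContDiff ℝ ∞ B)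
  (hK : ∀ t, |deriv B t| ≤ K) (hcK : ∀ x, |c x| * K < 1)
  (hBz : ∀ t ∉ Ioo (1 + η) (2 - η), B t = 0) (N : ℕ)

/-- **The `N`-fold iterated level move as an operation on long annuli**: `(R c B)^[N] ∘ F`, for
`B` vanishing off the open middle `(1 + η, 2 - η)` and `|c| · sup |B'| < 1`; same end curves,
same positions, levels moved inside the open middle only. [folklore] -/
def iterRelevelWith : LongAnnulus η where
  F := (R c B)^[N] ∘ A.F
  k₁ := A.k₁
  k₂ := A.k₂
  contDiff_F := (contDiff_iterate_R hc hB N).comp A.contDiff_F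
  η_pos := A.η_pos
  η_le := A.η_le
  F_add_one θ s := by simp only [comp_apply, A.F_add_one]
  collar₁ θ s hs := by
    simp only [comp_apply, A.collar₁ θ s hs, iterate_R_mk]
    rw [iterate_lmap_of_not_mem hBz _ N (fun h ↦ by linarith [h.1])]
  collar₂ θ s hs := by
    simp only [comp_apply, A.collar₂ θ s hs, iterate_R_mk]
    rw [iterate_lmap_of_not_mem hBz _ N (fun h ↦ by linarith [h.2])]
  margin η' hη' θ s hs := by
    simp only [comp_apply]
    have hm := A.margin η' hη' θ s hs
    rw [← Prod.mk.eta (p := A.F (θ, s)), iterate_R_mk]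
    by_cases hmid : (A.F (θ, s)).2 ∈ Ioo (1 + η) (2 - η)
    · have := iterate_lmap_mem_Ioo hB hK hcK hBz (A.F (θ, s)).1 N hmid
      exact ⟨by linarith [this.1, hη'.2], by linarith [this.2, hη'.2]⟩
    · rw [iterate_lmap_of_not_mem hBz _ N hmid]; exact hm
  margin_Ioo η' hη' θ s hs := by
    simp only [comp_apply]
    have hm := A.margin_Ioo η' hη' θ s hs
    rw [← Prod.mk.eta (p := A.F (θ, s)), iterate_R_mk]
    by_cases hmid : (A.F (θ, s)).2 ∈ Ioo (1 + η) (2 - η)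
    · have := iterate_lmap_mem_Ioo hB hK hcK hBz (A.F (θ, s)).1 N hmid
      exact ⟨by linarith [this.1, hη'.2], by linarith [this.2, hη'.2]⟩
    · rw [iterate_lmap_of_not_mem hBz _ N hmid]; exact hm
  inj p q hp hq he := A.inj p q hp hq (iterate_R_injective hB hK hcK N he)
  injective_fderiv p hp := by
    rw [fderiv_comp p (((contDiff_iterate_R hc hB N).differentiable (by simp)) _)
      ((A.contDiff_F.differentiable (by simp)) p)]
    exact (injective_fderiv_iterate_R hc hB hK hcK N _).comp (A.injective_fderiv p hp)

/-- The map of the new annulus. [folklore] -/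
@[simp] theorem iterRelevelWith_F : (A.iterRelevelWith c B hc hB hK hcK hBz N).F = (R c B)^[N] ∘ A.F := rfl

/-- Same lower end curve. [folklore] -/
@[simp] theorem iterRelevelWith_k₁ : (A.iterRelevelWith c B hc hB hK hcK hBz N).k₁ = A.k₁ := rfl

/-- Same upper end curve. [folklore] -/
@[simp] theorem iterRelevelWith_k₂ : (A.iterRelevelWith c B hc hB hK hcK hBz N).k₂ = A.k₂ := rfl

/-- Same positions. [folklore] -/
theorem fst_iterRelevelWith_F (p : ℝ × ℝ) : ((A.iterRelevelWith c B hc hB hK hcK hBz N).F p).1 = (A.F p).1 := by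
  simp only [iterRelevelWith_F, comp_apply]
  rw [← Prod.mk.eta (p := A.F p), iterate_R_mk]

/-- Levels off the open middle are untouched. [folklore] -/
theorem iterRelevelWith_F_of_not_mem {p : ℝ × ℝ} (hp : (A.F p).2 ∉ Ioo (1 + η) (2 - η)) :
    (A.iterRelevelWith c B hc hB hK hcK hBz N).F p = A.F p := by
  simp only [iterRelevelWith_F, comp_apply]
  rw [← Prod.mk.eta (p := A.F p), iterate_R_mk, iterate_lmap_of_not_mem hBz _ N hp]

/-- Levels in the open middle stay there. [folklore] -/
theorem snd_iterRelevelWith_F_mem {p : ℝ × ℝ} (hp : (A.F p).2 ∈ Ioo (1 + η) (2 - η)) :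
    ((A.iterRelevelWith c B hc hB hK hcK hBz N).F p).2 ∈ Ioo (1 + η) (2 - η) := by
  simp only [iterRelevelWith_F, comp_apply]
  rw [← Prod.mk.eta (p := A.F p), iterate_R_mk]
  exact iterate_lmap_mem_Ioo hB hK hcK hBz _ N hp

/-- The new annulus on a point in terms of the iterated level map. [folklore] -/
theorem iterRelevelWith_F_apply (p : ℝ × ℝ) :
    (A.iterRelevelWith c B hc hB hK hcK hBz N).F p = ((A.F p).1, (lmap c B (A.F p).1)^[N] (A.F p).2) := by
  simp only [iterRelevelWith_F, comp_apply]
  rw [← Prod.mk.eta (p := A.F p), iterate_R_mk]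

end IterRelevel

/-! ### Re-levelling a long annulus along its sheared spanning arc -/

/-- **The extension step**: given a generic shear parameter `v` for `(A, θ₁)`, a smooth function
`g : ℝ³ → ℝ`, `|g| ≤ 1`, which along the sheared spanning arc over `[1, 2]` is `τ - lev θ₁ τ`
(`ArcTube.exists_contDiff_extend` on the embedded middle arc, support radius below the distance
from the collar flanks of the arc, where both sides vanish). [folklore] -/
theorem exists_extension_along_arc (θ₁ : ℝ) {v : 𝔼 3 × 𝔼 3}
    (hv₁ : ∀ τ ∈ Icc (1 : ℝ) 2, ∀ τ' ∈ Icc (1 : ℝ) 2, A.spos v θ₁ τ = A.spos v θ₁ τ' →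
      A.lev θ₁ τ ∈ Ioo (1 + η / 4) (2 - η / 4) → τ = τ')
    (hv₂ : ∀ τ ∈ Icc (1 : ℝ) 2, A.lev θ₁ τ ∈ Ioo (1 + η / 4) (2 - η / 4) → deriv (A.spos v θ₁) τ ≠ 0) :
    ∃ g : 𝔼 3 → ℝ, ContDiff ℝ ∞ g ∧ (∀ y, |g y| ≤ 1) ∧
      ∀ τ ∈ Icc (1 : ℝ) 2, g (A.spos v θ₁ τ) = τ - A.lev θ₁ τ := by
  have hη := A.η_pos
  have hη4 := A.η_le
  -- levels of parameters in the tube range are in the open middle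
  have hlevmid : ∀ τ ∈ Icc (1 + 3 * η / 8) (2 - 3 * η / 8), A.lev θ₁ τ ∈ Ioo (1 + η / 4) (2 - η / 4) := by
    intro τ hτ
    have := A.margin (3 * η / 8) ⟨by positivity, by linarith⟩ θ₁ τ hτ
    show (A.F (θ₁, τ)).2 ∈ Ioo (1 + η / 4) (2 - η / 4)
    exact ⟨by linarith [this.1], by linarith [this.2]⟩
  have hIcc_of : ∀ {τ}, τ ∈ Icc (1 + 3 * η / 8) (2 - 3 * η / 8) → τ ∈ Icc (1 : ℝ) 2 := fun hτ ↦
    ⟨by linarith [hτ.1], by linarith [hτ.2]⟩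
  -- the arc is embedded and regular on `[1 + 3η/8, 2 - 3η/8] = [a - κ, b + κ]`, `a = 1 + η/2`
  have hinj : InjOn (A.spos v θ₁) (Icc (1 + η / 2 - η / 8) (2 - η / 2 + η / 8)) := by
    intro τ hτ τ' hτ' he
    have hτ₀ : τ ∈ Icc (1 + 3 * η / 8) (2 - 3 * η / 8) := ⟨by linarith [hτ.1], by linarith [hτ.2]⟩
    have hτ₀' : τ' ∈ Icc (1 + 3 * η / 8) (2 - 3 * η / 8) := ⟨by linarith [hτ'.1], by linarith [hτ'.2]⟩
    exact hv₁ τ (hIcc_of hτ₀) τ' (hIcc_of hτ₀') he (hlevmid τ hτ₀)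
  have hreg : ∀ τ ∈ Icc (1 + η / 2 - η / 8) (2 - η / 2 + η / 8), deriv (A.spos v θ₁) τ ≠ 0 := by
    intro τ hτ
    have hτ₀ : τ ∈ Icc (1 + 3 * η / 8) (2 - 3 * η / 8) := ⟨by linarith [hτ.1], by linarith [hτ.2]⟩
    exact hv₂ τ (hIcc_of hτ₀) (hlevmid τ hτ₀)
  -- the function to extend: `φ τ = τ - lev τ`, vanishing on the collars
  have hφs : ContDiff ℝ ∞ fun τ ↦ τ - A.lev θ₁ τ := contDiff_id.sub (A.contDiff_lev θ₁)
  have hφ_of_le : ∀ τ, τ ≤ 1 + η → τ - A.lev θ₁ τ = 0 := fun τ hτ ↦ by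
    simp only [LongAnnulus.lev, A.snd_F_of_le hτ, sub_self]
  have hφ_of_ge : ∀ τ, 2 - η ≤ τ → τ - A.lev θ₁ τ = 0 := fun τ hτ ↦ by
    simp only [LongAnnulus.lev, A.snd_F_of_ge hτ, sub_self]
  have hφa : ∀ τ, τ ≤ 1 + η / 2 → τ - A.lev θ₁ τ = 0 := fun τ hτ ↦ hφ_of_le τ (by linarith)
  have hφb : ∀ τ, 2 - η / 2 ≤ τ → τ - A.lev θ₁ τ = 0 := fun τ hτ ↦ hφ_of_ge τ (by linarith)
  have hφbound : ∀ τ ∈ Icc (1 : ℝ) 2, |τ - A.lev θ₁ τ| ≤ 1 := by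
    intro τ hτ
    have := A.snd_F_mem_Icc θ₁ hτ
    simp only [LongAnnulus.lev]
    rw [abs_le]
    constructor <;> linarith [this.1, this.2, hτ.1, hτ.2]
  -- the flanks of the arc keep a positive distance from its non-collar part
  have hdisj : ∀ τ ∈ Icc (1 : ℝ) (1 + η / 2) ∪ Icc (2 - η / 2) 2, ∀ τ' ∈ Icc (1 + η) (2 - η),
      A.spos v θ₁ τ ≠ A.spos v θ₁ τ' := by
    intro τ hτ τ' hτ' he
    have hτ'2 : τ' ∈ Icc (1 : ℝ) 2 := ⟨by linarith [hτ'.1], by linarith [hτ'.2]⟩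
    have hlev' : A.lev θ₁ τ' ∈ Ioo (1 + η / 4) (2 - η / 4) := by
      have := A.margin η ⟨hη.le, le_rfl⟩ θ₁ τ' hτ'
      show (A.F (θ₁, τ')).2 ∈ Ioo (1 + η / 4) (2 - η / 4)
      exact ⟨by linarith [this.1], by linarith [this.2]⟩
    have hτ2 : τ ∈ Icc (1 : ℝ) 2 := by
      rcases hτ with h | h
      · exact ⟨h.1, by linarith [h.2]⟩
      · exact ⟨by linarith [h.1], h.2⟩
    have := hv₁ τ' hτ'2 τ hτ2 he.symm hlev'
    rcases hτ with h | h
    · linarith [h.2, hτ'.1]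
    · linarith [h.1, hτ'.2]
  obtain ⟨ρ, hρ, hρdist⟩ : ∃ ρ : ℝ, 0 < ρ ∧ ∀ τ ∈ Icc (1 : ℝ) (1 + η / 2) ∪ Icc (2 - η / 2) 2,
      ∀ τ' ∈ Icc (1 + η) (2 - η), ρ ≤ dist (A.spos v θ₁ τ) (A.spos v θ₁ τ') := by
    have hKc : IsCompact ((Icc (1 : ℝ) (1 + η / 2) ∪ Icc (2 - η / 2) 2) ×ˢ Icc (1 + η) (2 - η)) :=
      (isCompact_Icc.union isCompact_Icc).prod isCompact_Icc
    have hne : ((Icc (1 : ℝ) (1 + η / 2) ∪ Icc (2 - η / 2) 2) ×ˢ Icc (1 + η) (2 - η)).Nonempty :=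
      ⟨(1, 1 + η), ⟨Or.inl ⟨le_rfl, by linarith⟩, ⟨le_rfl, by linarith⟩⟩⟩
    have hcont : Continuous fun q : ℝ × ℝ ↦ dist (A.spos v θ₁ q.1) (A.spos v θ₁ q.2) :=
      ((A.contDiff_spos v θ₁).continuous.comp continuous_fst).dist
        ((A.contDiff_spos v θ₁).continuous.comp continuous_snd)
    obtain ⟨q₀, hq₀, hmin⟩ := hKc.exists_isMinOn hne hcont.continuousOn
    rw [isMinOn_iff] at hmin
    have hq₀' : q₀.1 ∈ Icc (1 : ℝ) (1 + η / 2) ∪ Icc (2 - η / 2) 2 ∧ q₀.2 ∈ Icc (1 + η) (2 - η) :=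
      mem_prod.1 hq₀
    refine ⟨dist (A.spos v θ₁ q₀.1) (A.spos v θ₁ q₀.2), dist_pos.2 (hdisj _ hq₀'.1 _ hq₀'.2),
      fun τ hτ τ' hτ' ↦ ?_⟩
    exact hmin (τ, τ') (mem_prod.2 ⟨hτ, hτ'⟩)
  -- the smooth extension `g`
  obtain ⟨g, hgs, hgarc, hgsupp, hgbound⟩ := ArcTube.exists_contDiff_extend (A.contDiff_spos v θ₁)
    (a := 1 + η / 2) (b := 2 - η / 2) (κ := η / 8) (by linarith) (by positivity) hinj hreg hρ hφs hφa hφb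
  -- `g ∘ spos = φ` on the whole shear range
  have hg_flank : ∀ τ ∈ Icc (1 : ℝ) (1 + η / 2) ∪ Icc (2 - η / 2) 2, g (A.spos v θ₁ τ) = 0 := by
    intro τ hτ
    by_contra hne
    obtain ⟨τ', hτ', hφ', hd⟩ := hgsupp _ hne
    have hτ'c : τ' ∈ Icc (1 + η) (2 - η) := by
      constructor
      · by_contra h; exact hφ' (hφ_of_le τ' (not_le.1 h).le)
      · by_contra h; exact hφ' (hφ_of_ge τ' (not_le.1 h).le)
    exact absurd (hρdist τ hτ τ' hτ'c) (not_le.2 hd)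
  refine ⟨g, hgs, fun y ↦ ?_, fun τ hτ ↦ ?_⟩
  · obtain ⟨τ, hτ, hle⟩ := hgbound y
    exact hle.trans (hφbound τ ⟨by linarith [hτ.1], by linarith [hτ.2]⟩)
  · by_cases h1 : τ ≤ 1 + η / 2
    · rw [hg_flank τ (Or.inl ⟨hτ.1, h1⟩), hφa τ h1]
    by_cases h2 : 2 - η / 2 ≤ τ
    · rw [hg_flank τ (Or.inr ⟨h2, hτ.2⟩), hφb τ h2]
    push Not at h1 h2
    exact hgarc τ ⟨by linarith, by linarith⟩

/-- **Re-levelling along the sheared spanning arc.** Let `v` be a generic shear parameter for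
`(A, θ₁)` (the two conclusions of `exists_generic_shear`). Then there is a long annulus `B` of
width `η/4` with the same end curves as `A`, the same positions as the sheared annulus
`A.shearWith v`, the same levels wherever the level is off the open middle
`(1 + η/4, 2 - η/4)`, levels in the open middle where `A` has, and **level-true spanning arc**:
`B.F (θ₁, τ) = (spos v θ₁ τ, τ)` for all `τ ∈ [1, 2]`. (The `N`-fold iterate of the level move
`R (g/N) (plateau η)` with `g` from `exists_extension_along_arc` and `N > 2 sup |plateau'|`:
along the arc every step translates the level by `(τ - lev τ)/N` inside the plateau.)
[folklore] -/
theorem exists_relevel (θ₁ : ℝ) {v : 𝔼 3 × 𝔼 3}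
    (hv₁ : ∀ τ ∈ Icc (1 : ℝ) 2, ∀ τ' ∈ Icc (1 : ℝ) 2, A.spos v θ₁ τ = A.spos v θ₁ τ' →
      A.lev θ₁ τ ∈ Ioo (1 + η / 4) (2 - η / 4) → τ = τ')
    (hv₂ : ∀ τ ∈ Icc (1 : ℝ) 2, A.lev θ₁ τ ∈ Ioo (1 + η / 4) (2 - η / 4) → deriv (A.spos v θ₁) τ ≠ 0) :
    ∃ B : LongAnnulus (η / 4), B.k₁ = A.k₁ ∧ B.k₂ = A.k₂ ∧
      (∀ p, (B.F p).1 = ((A.shearWith v).F p).1) ∧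
      (∀ p, (A.F p).2 ∉ Ioo (1 + η / 4) (2 - η / 4) → B.F p = (A.shearWith v).F p) ∧
      (∀ p, (A.F p).2 ∈ Ioo (1 + η / 4) (2 - η / 4) → (B.F p).2 ∈ Ioo (1 + η / 4) (2 - η / 4)) ∧
      ∀ τ ∈ Icc (1 : ℝ) 2, B.F (θ₁, τ) = (A.spos v θ₁ τ, τ) := by
  have hη := A.η_pos
  have hη4 := A.η_le
  obtain ⟨g, hgs, hg_le, hg_arc⟩ := A.exists_extension_along_arc θ₁ hv₁ hv₂
  -- the plateau and the number of steps
  obtain ⟨K, hKpos, hK⟩ := exists_abs_deriv_plateau_le (η := η) hη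
  obtain ⟨N, hN⟩ := exists_nat_gt (2 * K)
  have hNpos : (0 : ℝ) < N := by linarith
  have hN0 : (N : ℝ) ≠ 0 := hNpos.ne'
  have hcs : ContDiff ℝ ∞ fun y ↦ g y / N := hgs.div_const _
  have hcK : ∀ y, |g y / N| * K < 1 := by
    intro y
    rw [abs_div, abs_of_pos hNpos]
    have : |g y| * K ≤ K := by nlinarith [hg_le y, abs_nonneg (g y)]
    rw [div_mul_eq_mul_div, div_lt_one hNpos]
    linarith
  have hBz : ∀ t ∉ Ioo (1 + η / 4) (2 - η / 4), plateau η t = 0 := fun t ht ↦ plateau_of_not_mem hη ht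
  set S := A.shearWith v with hS
  refine ⟨S.iterRelevelWith (fun y ↦ g y / N) (plateau η) hcs (contDiff_plateau η) hK hcK hBz N,
    rfl, rfl, fun p ↦ S.fst_iterRelevelWith_F _ _ hcs (contDiff_plateau η) hK hcK hBz N p,
    fun p hp ↦ S.iterRelevelWith_F_of_not_mem _ _ hcs (contDiff_plateau η) hK hcK hBz N hp,
    fun p hp ↦ S.snd_iterRelevelWith_F_mem _ _ hcs (contDiff_plateau η) hK hcK hBz N hp, fun τ hτ ↦ ?_⟩
  rw [S.iterRelevelWith_F_apply]
  have hS1 : (S.F (θ₁, τ)).1 = A.spos v θ₁ τ := rfl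
  have hS2 : (S.F (θ₁, τ)).2 = A.lev θ₁ τ := rfl
  rw [hS1, hS2]
  by_cases hmid : A.lev θ₁ τ ∈ Ioo (1 + η / 4) (2 - η / 4)
  · -- in the open middle: either a flank (no move needed, none happens) or the plateau
    by_cases hfl : τ ≤ 1 + η / 2 ∨ 2 - η / 2 ≤ τ
    · -- flank: `lev τ = τ` and `g (spos τ) = 0`
      have hlt : A.lev θ₁ τ = τ := by
        rcases hfl with h | h
        · exact A.snd_F_of_le (by linarith) θ₁
        · exact A.snd_F_of_ge (by linarith) θ₁
      have hc0 : g (A.spos v θ₁ τ) / N = 0 := by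
        rw [hg_arc τ hτ, hlt, sub_self, zero_div]
      have hstep : ∀ k : ℕ, (lmap (fun y ↦ g y / N) (plateau η) (A.spos v θ₁ τ))^[k] (A.lev θ₁ τ) =
          A.lev θ₁ τ := by
        intro k
        induction k with
        | zero => rfl
        | succ k ih => rw [Function.iterate_succ_apply', ih, lmap, hc0, zero_mul, add_zero]
      rw [hstep N, hlt]
    · -- plateau: `N` translations by `(τ - lev τ) / N`
      push Not at hfl
      have hτp : τ ∈ Icc (1 + 3 * η / 8) (2 - 3 * η / 8) := ⟨by linarith [hfl.1], by linarith [hfl.2]⟩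
      have hlevp : A.lev θ₁ τ ∈ Icc (1 + 3 * η / 8) (2 - 3 * η / 8) := A.margin (3 * η / 8)
        ⟨by positivity, by linarith⟩ θ₁ τ hτp
      have hcφ : (N : ℝ) * (g (A.spos v θ₁ τ) / N) = τ - A.lev θ₁ τ := by
        rw [hg_arc τ hτ]
        field_simp
      have hend : A.lev θ₁ τ + N * (g (A.spos v θ₁ τ) / N) ∈ Icc (1 + 3 * η / 8) (2 - 3 * η / 8) := by
        rw [hcφ, add_sub_cancel]; exact hτp
      rw [iterate_lmap_eq_add (c := fun y ↦ g y / N) (B := plateau η)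
        (fun s hs ↦ plateau_eq_one hη hs) hlevp hend N le_rfl, hcφ, add_sub_cancel]
  · -- off the open middle: a collar parameter, nothing moves
    rw [iterate_lmap_of_not_mem hBz _ N hmid]
    have : A.lev θ₁ τ = τ := by
      rcases not_and_or.1 hmid with h | h
      · exact A.snd_F_of_le ((A.le_of_snd_F_le (η' := η / 4) ⟨by positivity, by linarith⟩
          (not_lt.1 h)).trans (by linarith)) θ₁
      · exact A.snd_F_of_ge (le_trans (by linarith) (A.ge_of_le_snd_F (η' := η / 4)
          ⟨by positivity, by linarith⟩ (not_lt.1 h))) θ₁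
    rw [this]

end LongAnnulus

end Literature.Topology.FourManifolds
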